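import Mathlib
import Summits.CriticalPhenomena.SAWScalingLimit.Theorems.SAWDefectDecoherenceObservableToSLERGateTransferHexagon

/-!
# Gate transfer, lattice 2: membership and metric bounds for the level hexagons

Support file for the stub `stub_gateTransfer` (the gate transfer
`GateDecomposition → RenewalAccumulation → CarvedToSLE → HexTight → FullIdentification`) of the
line `bridge-gate-renewal` for the crux
`Summit.CriticalPhenomena.SAWScalingLimit.Theses.SAWDefectDecoherence.ObservableToSLER`
(item `stmt-CriticalPhenomena-14005`).

* rescaled centres of `hexBall c n` lie in `openHex δ c n` (hence in the interior of
  `contHex δ c n`), face centres never lie on `frontier (contHex δ c n)`, nested levels,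
  `ball (δ c_c) (n δ / 2) ⊆ openHex`, `contHex ⊆ closedBall (δ c_c) (3 (n + 1) δ)`;
* the gate point is the midpoint of the rescaled dual edge; adjacent honeycomb vertices differ by
  at most one in every row coordinate; distance bounds for face centres (registered sub-goal
  `stub_prefixDiameter`: a vertex of the level-`n` hexagon and a neighbour of such a vertex have
  rescaled centres within `6 n δ + 4 δ`).  Elementary; tagged [folklore].
-/

noncomputable section

open scoped BigOperators Topology NNReal ENNReal Classical BoundedContinuousFunction unitInterval
open Filter Set MeasureTheory Metric

namespace Summit.CriticalPhenomena.SAWScalingLimit.Theorems.ObservableToSLER.BridgeGate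

open Literature.Probability.LatticeModels (HexVertex hexGraph hexCenter triZeta Site polyline)
open Literature.Probability.RandomPlanarGeometry
open Literature.Probability.RandomPlanarGeometry.SAW
open Summit.CriticalPhenomena.SAWScalingLimit.Theorems.ObservableToSLE.Negative (hexCenter_re_im)

section HexagonMembership

variable {δ : ℝ} {c : HexVertex} {n : ℕ}

/-- The centre vertex lies in its own lattice hexagon. -/
theorem mem_hexBall_self (c : HexVertex) (n : ℕ) : c ∈ hexBall c n := fun i => by simp

/-- Lattice hexagons are nested. -/
theorem hexBall_mono {n₂ n : ℕ} (h : n₂ ≤ n) : hexBall c n₂ ⊆ hexBall c n :=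
  fun _ hv i => (hv i).trans (by exact_mod_cast h)

/-- **The rescaled centre of a vertex of the lattice hexagon lies in the open continuum
hexagon.** -/
theorem hexCenter_mem_openHex (hδ : 0 < δ) {v : HexVertex} (hv : v ∈ hexBall c n) :
    (δ : ℂ) * hexCenter v ∈ openHex δ c n := by
  intro i
  rw [skewCoord_mul_div i hδ.ne']
  obtain ⟨h1, h2⟩ := skewCoord_hexCenter_mem i v
  have h := hv i
  rw [abs_le] at h
  obtain ⟨h3, h4⟩ := h
  have h3' : (rowCoord i c : ℝ) - n ≤ rowCoord i v := by exact_mod_cast (by linarith : rowCoord i c - n ≤ rowCoord i v)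
  have h4' : (rowCoord i v : ℝ) ≤ rowCoord i c + n := by exact_mod_cast (by linarith : rowCoord i v ≤ rowCoord i c + n)
  constructor <;> linarith

/-- The continuum hexagon has nonempty interior. -/
theorem interior_contHex_nonempty (hδ : 0 < δ) (c : HexVertex) (n : ℕ) :
    (interior (contHex δ c n)).Nonempty :=
  ⟨_, openHex_subset_interior (hexCenter_mem_openHex hδ (mem_hexBall_self c n))⟩

/-- **Rescaled face centres never lie on the frontier of a continuum hexagon** (their skew
coordinates are not integers). -/
theorem hexCenter_not_mem_frontier (hδ : 0 < δ) (v : HexVertex) :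
    (δ : ℂ) * hexCenter v ∉ frontier (contHex δ c n) := by
  intro h
  have hK : (δ : ℂ) * hexCenter v ∈ contHex δ c n :=
    (isClosed_contHex δ c n).frontier_subset h
  have hO : (δ : ℂ) * hexCenter v ∉ openHex δ c n := fun h' => not_mem_frontier_of_mem_openHex h' h
  simp only [openHex, Set.mem_setOf_eq, not_forall, not_and_or, not_lt] at hO
  obtain ⟨i, hi⟩ := hO
  have hKi := hK i
  rw [skewCoord_mul_div i hδ.ne'] at hi hKi
  rcases hi with hi | hi
  · have heq : skewCoord i (hexCenter v) = ((rowCoord i c - n : ℤ) : ℝ) := by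
      push_cast; linarith [hKi.1]
    exact skewCoord_hexCenter_ne_int i v _ heq
  · have heq : skewCoord i (hexCenter v) = ((rowCoord i c + n + 1 : ℤ) : ℝ) := by
      push_cast; linarith [hKi.2]
    exact skewCoord_hexCenter_ne_int i v _ heq

/-- A smaller closed hexagon lies in the larger open one. -/
theorem contHex_subset_openHex {n₂ n : ℕ} (h : n₂ < n) : contHex δ c n₂ ⊆ openHex δ c n := by
  intro z hz i
  obtain ⟨h1, h2⟩ := hz i
  have h' : (n₂ : ℝ) + 1 ≤ n := by exact_mod_cast h
  constructor <;> linarith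

/-- The ball of radius `n δ / 2` about the rescaled centre lies in the open hexagon. -/
theorem ball_subset_openHex (hδ : 0 < δ) (c : HexVertex) (n : ℕ) :
    ball ((δ : ℂ) * hexCenter c) (n * δ / 2) ⊆ openHex δ c n := by
  intro z hz i
  rw [mem_ball, dist_eq_norm] at hz
  have hw : ‖z / δ - hexCenter c‖ < n / 2 := by
    have : z / δ - hexCenter c = (z - δ * hexCenter c) / δ := by
      field_simp [Complex.ofReal_ne_zero.2 hδ.ne']
    rw [this, norm_div, Complex.norm_real, Real.norm_eq_abs, abs_of_pos hδ, div_lt_iff₀ hδ]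
    linarith
  have hs := abs_skewCoord_le i (z / δ - hexCenter c)
  rw [skewCoord_sub, abs_le] at hs
  obtain ⟨h1, h2⟩ := skewCoord_hexCenter_mem i c
  constructor <;> nlinarith

/-- The closed hexagon lies in the ball of radius `3 (n + 1) δ` about the rescaled centre. -/
theorem contHex_subset_closedBall (hδ : 0 < δ) (c : HexVertex) (n : ℕ) :
    contHex δ c n ⊆ closedBall ((δ : ℂ) * hexCenter c) (3 * (n + 1) * δ) := by
  intro z hz
  rw [mem_closedBall, dist_eq_norm]
  have hw : ‖z - δ * hexCenter c‖ = δ * ‖z / δ - hexCenter c‖ := by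
    have : z - δ * hexCenter c = δ * (z / δ - hexCenter c) := by
      field_simp [Complex.ofReal_ne_zero.2 hδ.ne']
    rw [this, norm_mul, Complex.norm_real, Real.norm_eq_abs, abs_of_pos hδ]
  rw [hw]
  have hb : ∀ i : Fin 3, |skewCoord i (z / δ - hexCenter c)| ≤ n + 1 := by
    intro i
    rw [skewCoord_sub, abs_le]
    obtain ⟨h1, h2⟩ := skewCoord_hexCenter_mem i c
    obtain ⟨h3, h4⟩ := hz i
    constructor <;> linarith
  have h := norm_le_skewCoord (z / δ - hexCenter c)
  have h0 := hb 0
  have h1 := hb 1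
  nlinarith

/-- The gate point is the midpoint of the rescaled centres, hence on the segment between them. -/
theorem gatePoint_mem_segment (δ : ℝ) (p q : HexVertex) :
    gatePoint δ p q ∈ segment ℝ ((δ : ℂ) * hexCenter p) ((δ : ℂ) * hexCenter q) := by
  refine ⟨1 / 2, 1 / 2, by norm_num, by norm_num, by norm_num, ?_⟩
  rw [gatePoint]
  simp only [Complex.real_smul]
  push_cast
  ring

/-- **Adjacent honeycomb vertices differ by at most one in every row coordinate.** -/
theorem abs_rowCoord_sub_le_one_of_adj {p q : HexVertex} (h : hexGraph.Adj p q) (i : Fin 3) :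
    |rowCoord i p - rowCoord i q| ≤ 1 := by
  obtain ⟨x, s⟩ := p
  obtain ⟨y, t⟩ := q
  rw [hexGraph_adj_iff_coord] at h
  rw [abs_le]
  rcases h with ⟨rfl, rfl, h⟩ | ⟨rfl, rfl, h⟩ <;> rcases h with ⟨h1, h2⟩ | ⟨h1, h2⟩ | ⟨h1, h2⟩ <;>
    fin_cases i <;>
    simp only [rowCoord, Fin.isValue, Fin.zero_eta, ↓reduceIte, Fin.mk_one, one_ne_zero,
      Fin.reduceFinMk, Fin.reduceEq, Fin.val_zero, Fin.val_one, Nat.cast_zero, Nat.cast_one] <;>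
    omega

/-- Distance of two face centres in terms of the first two row coordinates:
`dist ≤ 3 k + 1` if both differ by at most `k`. -/
theorem dist_hexCenter_le {v w : HexVertex} {k : ℝ} (h0 : |(rowCoord 0 v : ℝ) - rowCoord 0 w| ≤ k)
    (h1 : |(rowCoord 1 v : ℝ) - rowCoord 1 w| ≤ k) : dist (hexCenter v) (hexCenter w) ≤ 3 * k + 1 := by
  obtain ⟨x, s⟩ := v
  obtain ⟨y, t⟩ := w
  obtain ⟨hre, him⟩ := hexCenter_re_im x s
  obtain ⟨hre', him'⟩ := hexCenter_re_im y t
  simp only [rowCoord, Fin.isValue, ↓reduceIte, one_ne_zero] at h0 h1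
  have hk : 0 ≤ k := (abs_nonneg _).trans h0
  have hs1 : ((s : ℕ) : ℝ) ≤ 1 := by exact_mod_cast Nat.lt_succ_iff.1 s.2
  have ht1 : ((t : ℕ) : ℝ) ≤ 1 := by exact_mod_cast Nat.lt_succ_iff.1 t.2
  have hs0 : (0 : ℝ) ≤ (s : ℕ) := Nat.cast_nonneg _
  have ht0 : (0 : ℝ) ≤ (t : ℕ) := Nat.cast_nonneg _
  rw [abs_le] at h0 h1
  rw [dist_eq_norm]
  refine (Complex.norm_le_abs_re_add_abs_im _).trans ?_
  rw [Complex.sub_re, Complex.sub_im, hre, him, hre', him']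
  have h3 := sqrt_three_lt_two
  have h3' := sqrt_three_pos
  have hA : |(x 0 : ℝ) + (x 1 : ℝ) / 2 + ((s : ℕ) + 1) / 2 - ((y 0 : ℝ) + (y 1 : ℝ) / 2 + ((t : ℕ) + 1) / 2)| ≤
      k + k / 2 + 1 / 2 := by
    rw [abs_le]; constructor <;> linarith
  have hB : |Real.sqrt 3 / 2 * ((x 1 : ℝ) + ((s : ℕ) + 1) / 3) - Real.sqrt 3 / 2 * ((y 1 : ℝ) + ((t : ℕ) + 1) / 3)| ≤
      k + 1 / 2 := by
    rw [← mul_sub, abs_mul, abs_of_pos (by positivity : (0 : ℝ) < Real.sqrt 3 / 2)]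
    have : |(x 1 : ℝ) + ((s : ℕ) + 1) / 3 - ((y 1 : ℝ) + ((t : ℕ) + 1) / 3)| ≤ k + 1 / 3 := by
      rw [abs_le]; constructor <;> linarith
    calc Real.sqrt 3 / 2 * |(x 1 : ℝ) + ((s : ℕ) + 1) / 3 - ((y 1 : ℝ) + ((t : ℕ) + 1) / 3)|
        ≤ 1 * (k + 1 / 3) := mul_le_mul (by linarith) this (abs_nonneg _) (by norm_num)
      _ ≤ k + 1 / 2 := by linarith
  linarith

/-- **Diameter bound for the prefix of a first exit**: a vertex of the lattice hexagon of level
`n` and a neighbour of a vertex of that hexagon have rescaled centres within `6 n δ + 4 δ`. -/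
theorem dist_hexCenter_le_of_mem_hexBall_of_adj (hδ : 0 < δ) {x p q : HexVertex}
    (hx : x ∈ hexBall c n) (hp : p ∈ hexBall c n) (hpq : hexGraph.Adj p q) :
    dist ((δ : ℂ) * hexCenter x) ((δ : ℂ) * hexCenter q) ≤ 6 * n * δ + 4 * δ := by
  have hk : ∀ i : Fin 3, |(rowCoord i x : ℝ) - rowCoord i q| ≤ 2 * n + 1 := by
    intro i
    have h1 := hx i
    have h2 := hp i
    have h3 := abs_rowCoord_sub_le_one_of_adj hpq i
    have : |rowCoord i x - rowCoord i q| ≤ 2 * n + 1 := by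
      rw [abs_le] at h1 h2 h3 ⊢; constructor <;> linarith [h1.1, h1.2, h2.1, h2.2, h3.1, h3.2]
    exact_mod_cast this
  have h := dist_hexCenter_le (hk 0) (hk 1)
  rw [dist_eq_norm] at h ⊢
  rw [← mul_sub, norm_mul, Complex.norm_real, Real.norm_eq_abs, abs_of_pos hδ]
  nlinarith

/-- If `p` lies in the hexagon of level `n₂ < n` and `q` is adjacent to `p`, then `q` lies in the
hexagon of level `n` (a lattice step changes row coordinates by at most one). -/
theorem mem_hexBall_of_adj_of_lt {n₂ n : ℕ} (h : n₂ < n) {p q : HexVertex} (hp : p ∈ hexBall c n₂)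
    (hpq : hexGraph.Adj p q) : q ∈ hexBall c n := by
  intro i
  have h1 := hp i
  have h2 := abs_rowCoord_sub_le_one_of_adj hpq i
  rw [abs_le] at h1 h2 ⊢
  have h' : (n₂ : ℤ) + 1 ≤ n := by exact_mod_cast h
  constructor <;> linarith [h1.1, h1.2, h2.1, h2.2]

end HexagonMembership

end Summit.CriticalPhenomena.SAWScalingLimit.Theorems.ObservableToSLER.BridgeGate

namespace Summit.CriticalPhenomena.SAWScalingLimit.Theorems.ObservableToSLER.BridgeGate

open Literature.Probability.LatticeModels (HexVertex hexGraph hexCenter triZeta Site)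
open Literature.Probability.RandomPlanarGeometry
open Literature.Probability.RandomPlanarGeometry.SAW

/-- **Registered sub-goal `stub_prefixDiameter`** (self-contained form of `dist_hexCenter_le_of_mem_hexBall_of_adj`). -/
theorem stub_prefixDiameter : ∀ (δ : ℝ) (c : HexVertex) (n : ℕ) (x p q : HexVertex), 0 < δ → x ∈ hexBall c n → p ∈ hexBall c n → hexGraph.Adj p q → dist ((δ : ℂ) * hexCenter x) ((δ : ℂ) * hexCenter q) ≤ 6 * n * δ + 4 * δ :=
  fun _ _ _ _ _ _ hδ hx hp hpq => dist_hexCenter_le_of_mem_hexBall_of_adj hδ hx hp hpq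

end Summit.CriticalPhenomena.SAWScalingLimit.Theorems.ObservableToSLER.BridgeGate

end
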